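import Summits.QuantumFields.BalabanUV.T4Continuum.Support.NE7BlockConstantExtension
import Summits.QuantumFields.BalabanUV.T4Continuum.Support.NE3RightInverseSupLetters
import HarnessLib

/-!
# NE7CovariantTentExtension — ROAD (B)'s INPUT `σ̃`, THE SHARP CHOICE: the COVARIANT TENT interpolant `σ̃ = tinterpW M W a` of the corner data `a(w) = log u(M•w)`
# (row NE3's K5c object: multilinear weights × parallel transport from each cube vertex along the tree word) is skew, `NM`-periodic, exact at the corners,
# `‖σ̃‖ ≤ 2θ_u`, and **`‖gaugeDir_W σ̃‖ ≤ corrC(d)∕M · 2θ_u`** — a factor `1∕M` below the block-constant extension of F109; file 45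

Cell `pub-balaban`, rung (B)+1 sub-cell t4, lineage `b2b-balaban-t4-ne7-p1` (CRUX PROVER NE7 #1 = OWNER of row NE7), generation 78; memo
`t4/b2b-balaban-t4-ne7-p1-g78/BUMP-CLASS-FLAT.md` §7 PPPS.  File F114 (over `NE3CovariantTentInterpolant` (`tinterpW`, `tinterpW_corner`, `tinterpW_mem_skewAdjoint`,
`tinterpW_add_period`), `NE3HatInvCurlLetters.norm_tinterpW_le_of_sup`, `NE3RightInverseSupLetters.norm_corrector_le` (the covariant corrector, pointwise), `MatrixLog`).
WHY.  F109's block-constant `σ̃` has `‖gaugeDir_W σ̃‖ ≍ ‖σ̃‖` (its docstring's "smoothness buys nothing" is true for NAIVE smoothness: `Ad(W⁻¹)σ̃ − σ̃(·+e)` is `O(‖σ̃‖)` when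
`W` is far from `1`).  COVARIANT smoothness does buy the factor `1∕M`: transporting each corner value along the block's tree before tenting makes the covariant difference
see only the transport defect (in-block holonomies, `O(M²x)`) and the coarse slot (weight `1∕M`) — row NE3 proved exactly this as the pointwise corrector letter
`‖gaugeDir W (tinterpW M W m)‖ ≤ corrC∕M·‖m‖_∞` under the class regime `M²x ≤ 1`.  With this `σ̃` in F108 (which displays `σ̃` freely), the gauge part of the structured
field `Z′ = Z − gaugeDir_W σ̃ + N` and hence its gradient member are `O(θ_u∕M)`, and `N = O((t+δ)(α+δ))` stays second order (memo §7 PPPS, reading (b)).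
WHAT ([folklore]; 0 def, 0 sorry).  **`exists_tent_extension`**: for `W` in the class (`LevelSmall k`, `SmallField x`, `M²x ≤ 1`, `M = L^{k+1}`, `NM`-periodic), `u` unitary
`NM`-periodic with `‖u − 1‖ ≤ θ ≤ 1∕4`: `∃ σ̃` skew, `NM`-periodic, `e^{σ̃(M•w)} = u(M•w)`, `‖σ̃‖ ≤ 2θ`, `‖gaugeDir_W σ̃‖ ≤ corrC(d)∕M·(2θ)`.
HONEST FRAMING (page 1): kinematics over landed row-NE3 objects; nothing of Bałaban's asserted; no letter of the curved (APE) discharged by itself; NOT ONE-STEP, NOT NE7; spine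
0∕9; finite T⁴ rung (B)+1 — NOT infinite volume, NOT mass gap, NOT `BetaPertH`, NOT Clay.  Continuum YM on T⁴ ⇐ BetaPertH ∧ nine spine estimates (0/9 proved); BetaPertH ⇐
(D1) ∧ (D4) ∧ CAP+tail; G-an2-4 gates asym, D1 and NE2/3/4.
-/

set_option autoImplicit false

open scoped BigOperators Matrix Matrix.Norms.L2Operator
open NormedSpace Finset

namespace Summit.QuantumFields.BalabanUV.T4Continuum.NE7CovariantTentExtension

open Literature.MathematicalPhysics.QuantumFieldTheory.Balaban1983to89
open B7Prop1Explicit B7Prop2Explicit MatrixLog UnitaryModel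
open T4AveragingDeficitWall (IsUnitaryCfg SmallField)
open T4AveragingDeficitWallBoundary (IsPeriodicCfg)
open AveragingDeficitMultiLevelPrep (LevelSmall)
open BlockAveragePushDirGauge (gaugeDir)
open NE3EnergyShapes (IsUnitarySite IsPeriodicSite)
open NE3.FlatLandauGaugeBond (mlog_mem_skewAdjoint_of_unitary)
open NE7ExpLogSecondOrder (norm_mlog_le_of_le)
open NE3CovariantTentInterpolant (tinterpW tinterpW_corner tinterpW_mem_skewAdjoint tinterpW_add_period)
open NE3HatInvCurlLetters (norm_tinterpW_le_of_sup)
open NE3RightInverseSupLetters (corrC norm_corrector_le)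

noncomputable section

variable {d : ℕ} {n : Type*} [Fintype n] [DecidableEq n]

/-- **THE COVARIANT TENT EXTENSION** (statement in the module docstring). [folklore] -/
theorem exists_tent_extension [Nonempty n] {L : ℕ} (hL : 2 ≤ L) (N k : ℕ)
    {W : Site d → Fin d → (Matrix n n ℂ)ˣ} {x : ℝ} (hWu : IsUnitaryCfg W) (hWP : IsPeriodicCfg W ((N * L ^ (k + 1) : ℕ) : ℤ))
    (hx : 0 ≤ x) (hs : LevelSmall d L k x) (hWx : SmallField W x) (hε : ((L : ℝ) ^ (k + 1)) ^ 2 * x ≤ 1)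
    {u : Site d → (Matrix n n ℂ)ˣ} (huU : IsUnitarySite u) (huP : IsPeriodicSite u ((N * L ^ (k + 1) : ℕ) : ℤ))
    {θ : ℝ} (hθ : ∀ y, ‖((u y : (Matrix n n ℂ)ˣ) : Matrix n n ℂ) - 1‖ ≤ θ) (hθ4 : θ ≤ 1 / 4) :
    ∃ σ : Site d → Matrix n n ℂ,
      (∀ y, σ y ∈ skewAdjoint (Matrix n n ℂ)) ∧ (∀ (y : Site d) (i : Fin d), σ (y + ((N * L ^ (k + 1) : ℕ) : ℤ) • e i) = σ y) ∧
      (∀ w : Site d, expUnit (σ ((((L ^ (k + 1) : ℕ) : ℤ)) • w)) = u ((((L ^ (k + 1) : ℕ) : ℤ)) • w)) ∧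
      (∀ y, ‖σ y‖ ≤ 2 * θ) ∧ (∀ (y : Site d) (κ : Fin d), ‖gaugeDir W σ y κ‖ ≤ corrC d / (L : ℝ) ^ (k + 1) * (2 * θ)) := by
  letI : CStarAlgebra (Matrix n n ℂ) := {}
  letI : NormedAlgebra ℚ (Matrix n n ℂ) := NormedAlgebra.restrictScalars ℚ ℝ (Matrix n n ℂ)
  have hM1 : 1 ≤ L ^ (k + 1) := Nat.one_le_pow _ _ (by omega)
  have hθ0 : 0 ≤ θ := (norm_nonneg _).trans (hθ 0)
  -- the corner data `a(w) = log u(M•w)` and the covariant tent interpolant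
  set a : Site d → Matrix n n ℂ := fun w => mlog ((u ((((L ^ (k + 1) : ℕ) : ℤ)) • w) : (Matrix n n ℂ)ˣ) : Matrix n n ℂ) with ha
  have has : ∀ w, a w ∈ skewAdjoint (Matrix n n ℂ) := fun w => mlog_mem_skewAdjoint_of_unitary (huU _) ((hθ _).trans hθ4)
  have hale : ∀ w, ‖a w‖ ≤ 2 * θ := fun w => norm_mlog_le_of_le (hθ _) hθ4
  have hP : (((L ^ (k + 1) : ℕ) : ℤ)) * (N : ℤ) = ((N * L ^ (k + 1) : ℕ) : ℤ) := by push_cast; ring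
  have haP : ∀ (z : Site d) (τ : Fin d), a (z + (N : ℤ) • e τ) = a z := by
    intro z τ
    show mlog ((u ((((L ^ (k + 1) : ℕ) : ℤ)) • (z + (N : ℤ) • e τ)) : (Matrix n n ℂ)ˣ) : Matrix n n ℂ)
      = mlog ((u ((((L ^ (k + 1) : ℕ) : ℤ)) • z) : (Matrix n n ℂ)ˣ) : Matrix n n ℂ)
    rw [smul_add, smul_smul, hP, huP]
  have hWP' : IsPeriodicCfg W ((((L ^ (k + 1) : ℕ) : ℤ)) * (N : ℕ)) := by rw [hP]; exact hWP
  refine ⟨tinterpW (L ^ (k + 1)) W a, fun y => tinterpW_mem_skewAdjoint _ hWu has y, fun y i => ?_, fun w => ?_,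
    fun y => norm_tinterpW_le_of_sup hM1 hWu a hale y, fun y κ => norm_corrector_le hL k hWu hx hs hWx hε a (by positivity) hale y κ⟩
  · -- periodicity
    have h := tinterpW_add_period hM1 hWP' haP y i
    rwa [Nat.mul_comm] at h
  · -- exact at the corners
    refine Units.ext ?_
    have h1 : ‖((u ((((L ^ (k + 1) : ℕ) : ℤ)) • w) : (Matrix n n ℂ)ˣ) : Matrix n n ℂ) - 1‖ < 1 := ((hθ _).trans hθ4).trans_lt (by norm_num)
    rw [val_expUnit, tinterpW_corner hM1 W a w]
    exact exp_mlog h1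

end

end Summit.QuantumFields.BalabanUV.T4Continuum.NE7CovariantTentExtension
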